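import Mathlib
import HarnessLib
import Literature.Analysis.FluidPDE.Tao2016AveragedNS.RenormalisedCascadeWaves
import Literature.Analysis.FluidPDE.Tao2016AveragedNS.ViscousEternalSolutions
import Literature.Analysis.FluidPDE.Tao2016AveragedNS.BoundedEternalSolutions

/-!
# Crux `TaoLadderRungTwoBreak.EternalRigidityViscBddOne` (stmt-NavierStokesRegularity-20420), stub (ω4)
# `stub_eternalLimitViscBdd`: RECENTRING SELECTION and the POST-PEAK ACTION BOUND

MODEL lattice ODEs of Tao 2016 §4 (log-time variables of §6.4) only; nothing here is a statement about the
Navier–Stokes equations; no stub, crux, rung or summit is closed (`--supports stmt-NavierStokesRegularity-20420`).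

CONTEXT.  The tree reduces (ω4) (`ViscousUpTo ∧ BlowsUpAt ∧ TypeOne ⟹` a uniformly bounded forward-(S₁)-surviving
admissible viscous eternal ω-limit) to ONE extra estimate, the a=1 energy ENVELOPE `(1+ε₀)^n‖X_n(t)‖² ≤ C`
(`…EternalRigidityViscBddOneLimitOfEnvelope.eternalLimitViscBdd_of_envelope`), and uses the envelope twice: to keep the
weighted energies of the recentred frames comparable along the front (survival of the limit) and to bound the per-shell
action after firing (admissibility of the limit).  This file supplies the two elementary facts that make both uses
envelope-free when the frames are recentred at RECORD shells and normalised by the peak weighted energy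
`g(m) = sup_t (1+ε₀)^m‖X_m(t)‖²` (which is `≥ c₀ν²` by the tree's firing floor, but need not be bounded):

* `exists_forall_mul_le_add` / `exists_strictMono_forall_mul_le_add` — **record selection**: a real sequence bounded
  below by `c > 0` admits, beyond every `J`, an index `m` with `θ·g(m) ≤ g(m+n)` for ALL `n ≥ 0` (any `θ < 1`), hence a
  strictly increasing sequence of such indices.  (If not, iterating the failure produces `g < θ^k g(J) → 0`.)  Recentring
  at such shells, the weighted energies of all later shells are `≥ θ` times that of the base shell, uniformly along the
  sequence — the survival clause of the limit needs no upper envelope.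
* `integral_norm_le_of_fwdBound` / `setIntegral_Ioi_norm_le_of_fwdBound` / `setIntegral_Ioi_norm_le_of_peak` — **post-peak
  action bound**: a forward bound `e^{2σ}‖V(σ)‖² ≤ P` on `[σ₀, ∞)` (the `bdd` clause of `IsEternal{,Visc}` verbatim, or
  «the physical shell energy never again exceeds its value at `σ₀`») forces `‖V(σ)‖ ≤ √P·e^{−σ}` there, so the log-time
  action of the shell after `σ₀` is at most `√P·e^{−σ₀}`; after a PEAK of the physical energy it is at most the
  renormalised amplitude `‖W_k(σ₀)‖` at the peak — i.e. at most the type-I constant, with no envelope.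

HONEST LABEL: elementary selection / integration lemmas; (ω3), (ω4), ⟨20420⟩ and every NS statement remain OPEN; the
remaining inputs for an envelope-free (ω4) (regularity criterion in the critical norm, front sharpness at level-reaching
times, rise-phase action) are NOT proved here.
-/

noncomputable section

-- the summit and its single sub-problem share the name (CONVENTIONS §1)
set_option linter.dupNamespace false

namespace Summit.NavierStokesRegularity.NavierStokesRegularity.Theorems.EternalRigidityViscBddOne.RecentringSelection

open Set Filter Topology MeasureTheory
open Literature.Analysis.FluidPDE Literature.Analysis.FluidPDE.TaoCascade

/-! ## §1 Record selection -/

/-- **Record selection.**  If `g : ℕ → ℝ` is bounded below by `c > 0` and `0 < θ < 1`, then beyond every `J` there is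
an index `m ≥ J` whose value is, up to the factor `θ`, a lower bound for ALL later values: `θ·g(m) ≤ g(m+n)` for every
`n`.  (Otherwise iterate the failure from `J`: the `k`-th iterate has `g < θ^k·g(J)`, eventually `< c`.)  Used to choose
recentring shells along a blow-up front at which the peak weighted energy is a near-minimum of its future.
[cite: Tao2016AveragedNS, §6.4 (self-similar variables; recentring of the renormalised trajectory); folklore] -/
theorem exists_forall_mul_le_add {g : ℕ → ℝ} {c θ : ℝ} (hc : 0 < c) (hg : ∀ m, c ≤ g m)
    (hθ0 : 0 < θ) (hθ1 : θ < 1) (J : ℕ) :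
    ∃ m : ℕ, J ≤ m ∧ ∀ n : ℕ, θ * g m ≤ g (m + n) := by
  classical
  by_contra h
  push Not at h
  have step : ∀ m : ℕ, J ≤ m → ∃ m' : ℕ, J ≤ m' ∧ g m' < θ * g m := by
    intro m hm
    obtain ⟨n, hn⟩ := h m hm
    exact ⟨m + n, hm.trans (Nat.le_add_right m n), hn⟩
  choose! f hfJ hfg using step
  set s : ℕ → ℕ := fun k => f^[k] J with hs
  have hsJ : ∀ k, J ≤ s k := by
    intro k
    induction k with
    | zero => simp [hs]
    | succ k ih =>
      simp only [hs, Function.iterate_succ_apply']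
      exact hfJ _ ih
  have hsg : ∀ k, g (s k) ≤ θ ^ k * g J := by
    intro k
    induction k with
    | zero => simp [hs]
    | succ k ih =>
      have h1 : g (s (k + 1)) < θ * g (s k) := by
        simp only [hs, Function.iterate_succ_apply']
        exact hfg _ (hsJ k)
      calc g (s (k + 1)) ≤ θ * g (s k) := h1.le
        _ ≤ θ * (θ ^ k * g J) := mul_le_mul_of_nonneg_left ih hθ0.le
        _ = θ ^ (k + 1) * g J := by ring
  have hgJ : 0 < g J := hc.trans_le (hg J)
  obtain ⟨k, hk⟩ := exists_pow_lt_of_lt_one (div_pos hc hgJ) hθ1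
  have hlt : g (s k) < c :=
    calc g (s k) ≤ θ ^ k * g J := hsg k
      _ < c / g J * g J := mul_lt_mul_of_pos_right hk hgJ
      _ = c := div_mul_cancel₀ c hgJ.ne'
  exact absurd (hg (s k)) (not_le.2 hlt)

/-- **Record selection along a sequence.**  Under the hypotheses of `exists_forall_mul_le_add` there is a strictly
increasing sequence of indices `φ j → ∞` with `θ·g(φ j) ≤ g(φ j + n)` for all `j, n`.
[cite: Tao2016AveragedNS, §6.4; folklore] -/
theorem exists_strictMono_forall_mul_le_add {g : ℕ → ℝ} {c θ : ℝ} (hc : 0 < c) (hg : ∀ m, c ≤ g m)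
    (hθ0 : 0 < θ) (hθ1 : θ < 1) :
    ∃ φ : ℕ → ℕ, StrictMono φ ∧ ∀ j n : ℕ, θ * g (φ j) ≤ g (φ j + n) := by
  choose m hmJ hm using fun J => exists_forall_mul_le_add hc hg hθ0 hθ1 J
  let φ : ℕ → ℕ := fun j => Nat.rec (m 0) (fun _ p => m (p + 1)) j
  have hφs : ∀ j, φ (j + 1) = m (φ j + 1) := fun j => rfl
  refine ⟨φ, strictMono_nat_of_lt_succ fun j => ?_, fun j n => ?_⟩
  · rw [hφs]
    exact Nat.lt_of_lt_of_le (Nat.lt_succ_self _) (hmJ _)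
  · cases j with
    | zero => exact hm 0 n
    | succ j => rw [hφs]; exact hm _ n

/-- The two-sided form at a record shell: later values are `≥ θ·g(m)`, and (trivially) `g(m) ≤ θ⁻¹·g(m+n)`.
[cite: Tao2016AveragedNS, §6.4; folklore] -/
theorem le_inv_mul_of_record {g : ℕ → ℝ} {θ : ℝ} (hθ0 : 0 < θ) {m : ℕ}
    (hrec : ∀ n : ℕ, θ * g m ≤ g (m + n)) (n : ℕ) : g m ≤ θ⁻¹ * g (m + n) := by
  have h := hrec n
  rw [le_inv_mul_iff₀ hθ0]
  exact h

/-! ## §2 The post-peak action bound -/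

/-- Pointwise form of a forward bound: `e^{2σ}‖V σ‖² ≤ P` gives `‖V σ‖ ≤ √P·e^{−σ}`.
[cite: Tao2016AveragedNS, §6.4 (the renormalised energy `e^{2σ}‖W_n‖²` is the physical shell energy); elementary] -/
theorem norm_le_sqrt_mul_exp_neg {E : Type*} [NormedAddCommGroup E] {V : ℝ → E} {σ P : ℝ}
    (hb : Real.exp (2 * σ) * ‖V σ‖ ^ 2 ≤ P) : ‖V σ‖ ≤ Real.sqrt P * Real.exp (-σ) := by
  have hexp : 0 < Real.exp σ := Real.exp_pos σ
  have hsq : (Real.exp σ * ‖V σ‖) ^ 2 ≤ P := by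
    have e1 : (Real.exp σ * ‖V σ‖) ^ 2 = Real.exp (2 * σ) * ‖V σ‖ ^ 2 := by
      have e2 : Real.exp σ ^ 2 = Real.exp (2 * σ) := by rw [sq, ← Real.exp_add]; ring_nf
      rw [mul_pow, e2]
    rw [e1]; exact hb
  have h1 : Real.exp σ * ‖V σ‖ ≤ Real.sqrt P := by
    have h0 : 0 ≤ Real.exp σ * ‖V σ‖ := by positivity
    calc Real.exp σ * ‖V σ‖ = Real.sqrt ((Real.exp σ * ‖V σ‖) ^ 2) := (Real.sqrt_sq h0).symm
      _ ≤ Real.sqrt P := Real.sqrt_le_sqrt hsq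
  rw [Real.exp_neg, ← div_eq_mul_inv, le_div_iff₀ hexp]
  calc ‖V σ‖ * Real.exp σ = Real.exp σ * ‖V σ‖ := mul_comm _ _
    _ ≤ Real.sqrt P := h1

/-- `∫_{σ₀}^{S} e^{−σ} dσ = e^{−σ₀} − e^{−S}`. [folklore] -/
theorem integral_exp_neg_interval (σ₀ S : ℝ) :
    ∫ σ in σ₀..S, Real.exp (-σ) = Real.exp (-σ₀) - Real.exp (-S) := by
  have h := intervalIntegral.integral_comp_neg (a := σ₀) (b := S) Real.exp
  rw [h, integral_exp]

/-- **Post-bound action on a finite window.**  If `V` is continuous and `e^{2σ}‖V σ‖² ≤ P` for `σ ≥ σ₀`, then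
`∫_{σ₀}^{S} ‖V‖ ≤ √P·e^{−σ₀}` for every `S ≥ σ₀`.
[cite: Tao2016AveragedNS, §6.4 (renormalised variables); elementary] -/
theorem integral_norm_le_of_fwdBound {E : Type*} [NormedAddCommGroup E] {V : ℝ → E} (hV : Continuous V)
    {σ₀ P : ℝ} (hb : ∀ σ, σ₀ ≤ σ → Real.exp (2 * σ) * ‖V σ‖ ^ 2 ≤ P) {S : ℝ} (hS : σ₀ ≤ S) :
    ∫ σ in σ₀..S, ‖V σ‖ ≤ Real.sqrt P * Real.exp (-σ₀) := by
  have hpt : ∀ σ ∈ Icc σ₀ S, ‖V σ‖ ≤ Real.sqrt P * Real.exp (-σ) :=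
    fun σ hσ => norm_le_sqrt_mul_exp_neg (hb σ hσ.1)
  have cN : Continuous fun σ => ‖V σ‖ := hV.norm
  have cR : Continuous fun σ => Real.sqrt P * Real.exp (-σ) := by fun_prop
  have hmono := intervalIntegral.integral_mono_on (μ := volume) hS (cN.intervalIntegrable _ _)
    (cR.intervalIntegrable _ _) hpt
  have hR : ∫ σ in σ₀..S, Real.sqrt P * Real.exp (-σ) = Real.sqrt P * (Real.exp (-σ₀) - Real.exp (-S)) := by
    rw [intervalIntegral.integral_const_mul, integral_exp_neg_interval]
  rw [hR] at hmono
  have hP : 0 ≤ Real.sqrt P := Real.sqrt_nonneg P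
  nlinarith [Real.exp_pos (-S), mul_nonneg hP (Real.exp_pos (-S)).le]

/-- **Post-bound action on the half-line.**  If moreover `‖V‖` is integrable on `(σ₀, ∞)`, then
`∫_{(σ₀,∞)} ‖V‖ ≤ √P·e^{−σ₀}`.
[cite: Tao2016AveragedNS, §6.4; elementary] -/
theorem setIntegral_Ioi_norm_le_of_fwdBound {E : Type*} [NormedAddCommGroup E] {V : ℝ → E} (hV : Continuous V)
    {σ₀ P : ℝ} (hb : ∀ σ, σ₀ ≤ σ → Real.exp (2 * σ) * ‖V σ‖ ^ 2 ≤ P)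
    (hint : IntegrableOn (fun σ => ‖V σ‖) (Ioi σ₀)) :
    ∫ σ in Ioi σ₀, ‖V σ‖ ≤ Real.sqrt P * Real.exp (-σ₀) := by
  have hlim := MeasureTheory.intervalIntegral_tendsto_integral_Ioi σ₀ hint tendsto_id
  refine le_of_tendsto hlim ?_
  filter_upwards [eventually_ge_atTop σ₀] with S hS
  exact integral_norm_le_of_fwdBound hV hb hS

/-! ## §3 Application to admissible eternal solutions -/

variable {m : ℕ} {ε₀ νh : ℝ} {α : Fin m → Fin m → Fin m → ℤ × ℤ × ℤ → ℝ} {W : ℤ → ℝ → Em m}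

/-- **Action after a forward bound.**  For an admissible viscous eternal solution (any `ν̂ ≥ 0`), a forward bound
`e^{2σ}‖W_k(σ)‖² ≤ P` on `[σ₀, ∞)` — the `bdd` clause verbatim — bounds the log-time action of shell `k` after `σ₀`:
`∫_{(σ₀,∞)} ‖W_k‖ ≤ √P·e^{−σ₀}`.
[cite: Tao2016AveragedNS, §4 Lemma 4.1 (4.8), (4.10), §6.4; cell vocabulary `IsEternalVisc`] -/
theorem action_after_le_of_fwdBound (hW : IsEternalVisc ε₀ νh α W) (k : ℤ) {σ₀ P : ℝ}
    (hb : ∀ σ, σ₀ ≤ σ → Real.exp (2 * σ) * ‖W k σ‖ ^ 2 ≤ P) :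
    ∫ σ in Ioi σ₀, ‖W k σ‖ ≤ Real.sqrt P * Real.exp (-σ₀) := by
  obtain ⟨M, hM⟩ := hW.action
  -- continuity of the shell in log-time (tree: `WakeRatchetOrthant.continuous_shell`), inlined
  have hcont : Continuous (W k) := continuous_iff_continuousAt.2 fun σ => (hW.law k σ).continuousAt
  exact setIntegral_Ioi_norm_le_of_fwdBound hcont hb (hM k).1.integrableOn

/-- **The post-peak action bound.**  For an admissible viscous eternal solution at `ε₀ > −1` (any `ν̂ ≥ 0`): if the
physical energy of shell `k` never again exceeds its value at log-time `σ₀` (`physEnergy k σ ≤ physEnergy k σ₀` for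
`σ ≥ σ₀` — e.g. `σ₀` a peak), then the action of shell `k` after `σ₀` is at most its renormalised amplitude at `σ₀`:
`∫_{(σ₀,∞)} ‖W_k‖ ≤ ‖W_k(σ₀)‖` (hence at most the uniform / type-I bound, with no energy envelope).
[cite: Tao2016AveragedNS, §4 Lemma 4.1 (4.8)–(4.10), §6.4 (self-similar variables); cell vocabulary `physEnergy`] -/
theorem setIntegral_Ioi_norm_le_of_peak (hε : -1 < ε₀) (hW : IsEternalVisc ε₀ νh α W) (k : ℤ) {σ₀ : ℝ}
    (hpk : ∀ σ, σ₀ ≤ σ → physEnergy ε₀ W k σ ≤ physEnergy ε₀ W k σ₀) :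
    ∫ σ in Ioi σ₀, ‖W k σ‖ ≤ ‖W k σ₀‖ := by
  have hΛ : 0 < bigLam ε₀ := bigLam_pos hε
  have hc : 0 < ((bigLam ε₀ ^ k)⁻¹) ^ 2 := by positivity
  set P : ℝ := Real.exp (2 * σ₀) * ‖W k σ₀‖ ^ 2 with hP
  have hb : ∀ σ, σ₀ ≤ σ → Real.exp (2 * σ) * ‖W k σ‖ ^ 2 ≤ P := by
    intro σ hσ
    have h := hpk σ hσ
    unfold physEnergy at h
    exact le_of_mul_le_mul_left h hc
  have h := action_after_le_of_fwdBound hW k hb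
  have hsqrt : Real.sqrt P = Real.exp σ₀ * ‖W k σ₀‖ := by
    have e1 : P = (Real.exp σ₀ * ‖W k σ₀‖) ^ 2 := by
      have e2 : Real.exp σ₀ ^ 2 = Real.exp (2 * σ₀) := by rw [sq, ← Real.exp_add]; ring_nf
      rw [hP, mul_pow, e2]
    rw [e1, Real.sqrt_sq (by positivity)]
  rw [hsqrt] at h
  calc ∫ σ in Ioi σ₀, ‖W k σ‖ ≤ Real.exp σ₀ * ‖W k σ₀‖ * Real.exp (-σ₀) := h
    _ = ‖W k σ₀‖ := by
      rw [mul_comm, ← mul_assoc, ← Real.exp_add, neg_add_cancel, Real.exp_zero, one_mul]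

/-- The same for an INVISCID admissible eternal solution (`IsEternal`, i.e. `ν̂ = 0`).
[cite: Tao2016AveragedNS, §4 Lemma 4.1 (4.8)–(4.10), §6.4; cell vocabulary `IsEternal`] -/
theorem setIntegral_Ioi_norm_le_of_peak_inviscid (hε : -1 < ε₀) (hW : IsEternal ε₀ α W) (k : ℤ) {σ₀ : ℝ}
    (hpk : ∀ σ, σ₀ ≤ σ → physEnergy ε₀ W k σ ≤ physEnergy ε₀ W k σ₀) :
    ∫ σ in Ioi σ₀, ‖W k σ‖ ≤ ‖W k σ₀‖ :=
  setIntegral_Ioi_norm_le_of_peak hε hW.isEternalVisc k hpk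

/-! ## §4 Recentring covariance (shell shift × log-time translation) -/

/-- **General recentring.**  For `ε₀ > −1`, recentring an admissible viscous eternal solution at shell `d` and log-time
`s`, `(n, σ) ↦ W_{n+d}(σ+s)`, gives an admissible eternal solution of the SAME table with covariant viscosity
`ν̂' = e^{2d·log(1+ε₀) − s}·ν̂ = ν̂(1+ε₀)^{2d}e^{−s}` (composition of the tree's `isEternalVisc_shift` and
`IsEternalVisc.translate`).  The values of `W` are unchanged, so a uniform (type-I) bound is inherited verbatim; the
a=1-weighted energies are multiplied by `(1+ε₀)^{4d}e^{−2s} = (ν̂'/ν̂)²` — the normalisation of the weighted energy and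
of the viscosity are LOCKED, which is why recentring at record shells with `e^{2s} = (1+ε₀)^{4d}·g(d)` keeps `ν̂'` bounded.
[cite: Tao2016AveragedNS, §4 (4.1) (scale weights) and §6.4 (self-similar variables); tree `isEternalVisc_shift`, `IsEternalVisc.translate`] -/
theorem isEternalVisc_recentre (hε : -1 < ε₀) (hW : IsEternalVisc ε₀ νh α W) (d : ℤ) (s : ℝ) :
    IsEternalVisc ε₀ (Real.exp (2 * (d : ℝ) * Real.log (1 + ε₀) - s) * νh) α
      (fun n σ => W (n + d) (σ + s)) := by
  have h1 := isEternalVisc_shift hε hW d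
  have h2 := h1.translate (2 * (d : ℝ) * Real.log (1 + ε₀) - s)
  refine (congrArg (IsEternalVisc ε₀ (Real.exp (2 * (d : ℝ) * Real.log (1 + ε₀) - s) * νh) α) ?_).mp h2
  funext n σ
  show W (n + d) (σ - (2 * (d : ℝ) * Real.log (1 + ε₀) - s) + 2 * (d : ℝ) * Real.log (1 + ε₀)) = W (n + d) (σ + s)
  congr 1
  ring

/-- The recentred viscosity in product form: `e^{2d·log(1+ε₀) − s}·ν̂ = ν̂·(1+ε₀)^{2d}·e^{−s}`.
[cite: Tao2016AveragedNS, §6.4; elementary] -/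
theorem recentre_visc_eq (hε : -1 < ε₀) (νh : ℝ) (d : ℤ) (s : ℝ) :
    Real.exp (2 * (d : ℝ) * Real.log (1 + ε₀) - s) * νh = νh * (1 + ε₀) ^ (2 * d) * Real.exp (-s) := by
  have hx : 0 < 1 + ε₀ := by linarith
  rw [Real.exp_sub, div_eq_mul_inv, ← Real.exp_neg]
  have e1 : Real.exp (2 * (d : ℝ) * Real.log (1 + ε₀)) = (1 + ε₀) ^ (2 * d) := by
    rw [← Real.exp_log (zpow_pos hx (2 * d)), Real.log_zpow]
    congr 1
    push_cast
    ring
  rw [e1]; ring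

/-- Uniform bounds are inherited by every recentring (the values are unchanged).
[cite: Tao2016AveragedNS, §6.4; elementary] -/
theorem forall_norm_recentre_le {B : ℝ} (hB : ∀ (k : ℤ) (σ : ℝ), ‖W k σ‖ ≤ B) (d : ℤ) (s : ℝ) :
    ∀ (k : ℤ) (σ : ℝ), ‖(fun n σ' => W (n + d) (σ' + s)) k σ‖ ≤ B :=
  fun k σ => hB (k + d) (σ + s)

end Summit.NavierStokesRegularity.NavierStokesRegularity.Theorems.EternalRigidityViscBddOne.RecentringSelection

end
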